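import Literature.AlgebraicGeometry.Resolution.HasseSchmidtFrobeniusCongruence
import Literature.AlgebraicGeometry.Resolution.SmoothStalkOrderCriterion
import HarnessLib

/-!
# Adapted Hasse–Schmidt homomorphisms at closed points of smooth schemes, and the Frobenius congruence there

Topic: `Literature/AlgebraicGeometry/Resolution`. `SmoothPointOrderCriterion.lean` /
`SmoothStalkOrderCriterion.lean` assemble, INSIDE the proof of the order criterion, the following datum at the local
ring `O = A_𝔭` of a maximal ideal `𝔭` of a `K`-algebra `A` of finite type which is formally étale over a polynomial
ring `K[X_σ]`, `K` a PERFECT field (this covers `𝒪_{Z,ξ}` for `Z` smooth over `K` and `ξ` closed): a ring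
homomorphism `T : O → O⟦t_σ⟧` with `constantCoeff ∘ T = id` sending `K` to constants («Hasse–Schmidt homomorphism»,
the localised Taylor lift of `HasseSchmidtEtaleLift.lean`) together with generators `u_i` of `𝔪_O` ADAPTED to `T`
to first order, `D^{[e_j]} u_i ≡ δ_ij (mod 𝔪_O)` (`u_i = π_i(x_i)/π_i′(x_i)`, `π_i` the separable minimal polynomials
of the coordinates of the point). This file EXPORTS that datum as an existence theorem, so that every statement of
`HasseSchmidtLocalCriterion.lean` / `HasseSchmidtFrobeniusCongruence.lean` proved «for a local ring with an adapted
Hasse–Schmidt homomorphism» becomes available at such points without re-running the assembly: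

* `exists_hasseSchmidt_adapted_of_etaleCoordinates` — the datum `(T, u)` at `O = A_𝔭`;
* `exists_hasseSchmidt_adapted_stalk_of_smooth` — the datum at `𝒪_{Z,ξ}`, `ξ` a closed point of a scheme `Z`
  smooth over a perfect field (`K`-structure `K → Γ(Z,𝒪_Z) → 𝒪_{Z,ξ}`, `stalkAlgebra`), with `σ = Fin d`;
* `exists_isDiffOpLE_pow_mul_sub_mem_pow_of_etaleCoordinates`, `exists_isDiffOpLE_pow_mul_sub_mem_pow_stalk_of_smooth`
  — **the Frobenius congruence at closed points**: for `g ∈ 𝔪^q ∖ 𝔪^{q+1}` there is a unit `v` such that for every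
  `N` some `K`-linear differential operator `D` of order `≤ p^N q` satisfies `D(g^{p^N} F) − v^{p^N} F ∈ 𝔪^{p^N}` for all
  `F` (`p` the characteristic exponent).

Motivation (nothing of it asserted here): the local-ring form of Eq. (47) of H. Hironaka's 2017 manuscript (p.31
l.9–19), requested by the campaign `res-hironaka` (CELL/STATUS LIB-WANTED 2026-08-27T00:26:14Z «for O regular local
ess. finite type / K perfect, g ∈ 𝔪^q ∖ 𝔪^{q+1}: ∃ D_ℓ ∈ Diff^{≤ q p^ℓ}, u unit, ∀ F, D_ℓ(g^{p^ℓ}F) − u^{p^ℓ}F ∈ 𝔪^{p^ℓ}»).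

## Sources
* [EGAIV4] A. Grothendieck, J. Dieudonné, ÉGA IV₄ (1967), §16.8, Thm. 16.11.2, §17.6 (étale coordinates).
* [Matsumura1987] H. Matsumura, *Commutative Ring Theory* (1986), §25–§27.
* [VillamayorU2008ReesDiff] O. Villamayor U., *Rees algebras on smooth schemes: integral closure and higher
  differential operators*, Rev. Mat. Iberoam. 24 (2008), §4.1, Remark 4.3.
-/

noncomputable section

namespace Literature.AlgebraicGeometry.Resolution

open IsLocalRing MvPowerSeries CategoryTheory TopologicalSpace _root_.AlgebraicGeometry

universe u v w

section EtaleCoordinates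

variable (K : Type u) [Field K] {σ : Type v} [Fintype σ] [DecidableEq σ]
  {A : Type w} [CommRing A] [Algebra K A] [Algebra (MvPolynomial σ K) A] [IsScalarTower K (MvPolynomial σ K) A]

omit [Fintype σ] in
/-- The linear coefficient of `C a + t_i` is `δ_ij`. [folklore] -/
private theorem coeff_single_C_add_X' (a : A) (i j : σ) :
    coeff (Finsupp.single j 1) (MvPowerSeries.C a + MvPowerSeries.X i : MvPowerSeries σ A) =
      if i = j then 1 else 0 := by
  rw [map_add, MvPowerSeries.coeff_C, MvPowerSeries.coeff_X, if_neg (Finsupp.single_ne_zero.mpr one_ne_zero)]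
  simp only [zero_add, Finsupp.single_left_inj one_ne_zero, eq_comm]

/-- **Adapted Hasse–Schmidt homomorphism at a closed point of an algebra étale over affine space.** `K` perfect,
`A` of finite type over `K`, formally smooth and formally unramified over `K[X_σ]`, `𝔭 ⊂ A` maximal, `O = A_𝔭` with its
`K`-structure: there are a ring homomorphism `T : O → O⟦t_σ⟧` with `constantCoeff ∘ T = id` sending `K` to constants
and generators `u_i` (`i ∈ σ`) of `𝔪_O` with `D^{[e_j]} u_i − δ_ij ∈ 𝔪_O` (the localised Taylor lift of
`exists_hasseSchmidt_of_formallySmooth`; `u_i = π_i(x_i) π_i′(x_i)⁻¹` for the separable minimal polynomials `π_i` of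
the coordinates of the point, `maximalIdeal_eq_span_aeval_of_formallyUnramified`).
[cite: EGAIV4, Thm. 16.11.2 and §17.6] [cite: VillamayorU2008ReesDiff, §4.1 and Remark 4.3] -/
theorem exists_hasseSchmidt_adapted_of_etaleCoordinates [PerfectField K]
    [Algebra.FormallySmooth (MvPolynomial σ K) A] [Algebra.FormallyUnramified (MvPolynomial σ K) A]
    [Algebra.FiniteType K A] (𝔭 : Ideal A) [𝔭.IsMaximal] (O : Type*) [CommRing O] [IsLocalRing O] [Algebra A O]
    [IsLocalization.AtPrime O 𝔭] [Algebra K O] [IsScalarTower K A O] :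
    ∃ (T : O →+* MvPowerSeries σ O) (u : σ → O),
      (∀ b, constantCoeff (T b) = b) ∧
      (∀ c : K, T (algebraMap K O c) = MvPowerSeries.C (algebraMap K O c)) ∧
      Ideal.span (Set.range u) = maximalIdeal O ∧
      ∀ i j, hsComponent T (Finsupp.single j 1) (u i) - (if i = j then 1 else 0) ∈ maximalIdeal O := by
  -- the coordinates `x_i ∈ A`
  set x : σ → A := fun i => algebraMap (MvPolynomial σ K) A (MvPolynomial.X i) with hx
  -- (1) Hasse–Schmidt homomorphism on `A` extending the Taylor shift, and on `O`
  obtain ⟨TA, hTA0, hTAR⟩ := exists_hasseSchmidt_of_formallySmooth K A (σ := σ)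
  have hTAK : ∀ c : K, TA (algebraMap K A c) = MvPowerSeries.C (algebraMap K A c) := by
    intro c
    have hc : algebraMap K A c = algebraMap (MvPolynomial σ K) A (MvPolynomial.C c) := by
      rw [← MvPolynomial.algebraMap_eq, ← IsScalarTower.algebraMap_apply]
    conv_lhs => rw [hc, hTAR, MvPolynomial.eval₂_C]
    rfl
  have hTAx : ∀ i, TA (x i) = MvPowerSeries.C (x i) + MvPowerSeries.X i := by
    intro i
    rw [hx]
    simp only [hTAR, MvPolynomial.eval₂_X]
  obtain ⟨T, hT0, hTK, hTA⟩ := exists_hasseSchmidt_localization TA O 𝔭.primeCompl hTA0 hTAK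
  have hTcomp : ∀ (β : σ →₀ ℕ) (a : A),
      hsComponent T β (algebraMap A O a) = algebraMap A O (hsComponent TA β a) := by
    intro β a
    simp only [hsComponent, hTA, MvPowerSeries.coeff_map]
  -- (2) the residue field and the separable minimal polynomials of the coordinates of the point
  letI := Ideal.Quotient.field 𝔭
  haveI : Algebra.FiniteType K (A ⧸ 𝔭) :=
    Algebra.FiniteType.of_surjective (Ideal.Quotient.mkₐ K 𝔭) (Ideal.Quotient.mkₐ_surjective K 𝔭)
  haveI : Module.Finite K (A ⧸ 𝔭) := finite_of_finite_type_of_isJacobsonRing K (A ⧸ 𝔭)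
  set a : σ → A ⧸ 𝔭 := fun i => Ideal.Quotient.mk 𝔭 (x i) with ha
  have hint : ∀ i, IsIntegral K (a i) := fun i => Algebra.IsIntegral.isIntegral (a i)
  set π : σ → Polynomial K := fun i => minpoly K (a i) with hπ
  have hπsep : ∀ i, (π i).Separable := fun i =>
    PerfectField.separable_of_irreducible (minpoly.irreducible (hint i))
  have hπ𝔭 : ∀ i, Polynomial.aeval (x i) (π i) ∈ 𝔭 := by
    intro i
    rw [← Ideal.Quotient.eq_zero_iff_mem, ← Ideal.Quotient.algebraMap_eq, ← Polynomial.aeval_algebraMap_apply,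
      Ideal.Quotient.algebraMap_eq]
    exact minpoly.aeval K (a i)
  have hπ'𝔭 : ∀ i, Polynomial.aeval (x i) (Polynomial.derivative (π i)) ∉ 𝔭 := by
    intro i hmem
    apply (hπsep i).aeval_derivative_ne_zero (minpoly.aeval K (a i))
    rw [ha]
    simp only
    rw [← Ideal.Quotient.algebraMap_eq, Polynomial.aeval_algebraMap_apply, Ideal.Quotient.algebraMap_eq,
      Ideal.Quotient.eq_zero_iff_mem]
    exact hmem
  -- (3) the maximal ideal of `O` is generated by the `w_i = π_i(x_i)`
  have hmax := maximalIdeal_eq_span_aeval_of_formallyUnramified K 𝔭 O π hπsep hπ𝔭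
  set w : σ → O := fun i => algebraMap A O (Polynomial.aeval (x i) (π i)) with hw
  have hmax' : maximalIdeal O = Ideal.span (Set.range w) := hmax
  have hw𝔪 : ∀ i, w i ∈ maximalIdeal O := fun i => hmax' ▸ Ideal.subset_span ⟨i, rfl⟩
  -- the units `v_i = π_i′(x_i)` and the adapted generators `u_i = w_i v_i⁻¹`
  have hv : ∀ i, IsUnit (algebraMap A O (Polynomial.aeval (x i) (Polynomial.derivative (π i)))) := fun i =>
    IsLocalization.map_units O (⟨_, hπ'𝔭 i⟩ : 𝔭.primeCompl)
  set u : σ → O := fun i => w i * ↑(hv i).unit⁻¹ with hu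
  have hspan : Ideal.span (Set.range u) = maximalIdeal O := by
    rw [hmax']
    apply le_antisymm
    · rw [Ideal.span_le]
      rintro _ ⟨i, rfl⟩
      exact Ideal.mul_mem_right _ _ (Ideal.subset_span ⟨i, rfl⟩)
    · rw [Ideal.span_le]
      rintro _ ⟨i, rfl⟩
      have : w i = u i * ↑(hv i).unit := by
        rw [hu]
        simp only
        rw [mul_assoc, Units.inv_mul, mul_one]
      rw [SetLike.mem_coe, this]
      exact Ideal.mul_mem_right _ _ (Ideal.subset_span ⟨i, rfl⟩)
  -- first-order adaptation `D^{[e_j]} u_i ≡ δ_ij (mod 𝔪)`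
  have hDw : ∀ i j, hsComponent T (Finsupp.single j 1) (w i) =
      algebraMap A O (Polynomial.aeval (x i) (Polynomial.derivative (π i))) * (if i = j then 1 else 0) := by
    intro i j
    rw [hw]
    simp only
    rw [hTcomp, hsComponent_single_aeval TA hTA0 hTAK, map_mul]
    congr 1
    rw [hsComponent, hTAx, coeff_single_C_add_X']
    split_ifs <;> simp
  have hlin : ∀ i j, hsComponent T (Finsupp.single j 1) (u i) - (if i = j then 1 else 0) ∈ maximalIdeal O := by
    intro i j
    rw [hu]
    simp only
    rw [hsComponent_single_mul T hT0, hDw]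
    have hrest : w i * hsComponent T (Finsupp.single j 1) ↑(hv i).unit⁻¹ ∈ maximalIdeal O :=
      Ideal.mul_mem_right _ _ (hw𝔪 i)
    have hvv : algebraMap A O (Polynomial.aeval (x i) (Polynomial.derivative (π i))) * ↑(hv i).unit⁻¹ = 1 :=
      (hv i).mul_val_inv
    split_ifs with hij
    · rw [mul_one, hvv, add_sub_cancel_left]
      exact hrest
    · rw [mul_zero, zero_mul, zero_add, sub_zero]
      exact hrest
  exact ⟨T, u, hT0, hTK, hspan, hlin⟩

/-- **Frobenius congruence at a closed point of an algebra étale over affine space** (`K` perfect of characteristic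
exponent `p`, setting of `exists_hasseSchmidt_adapted_of_etaleCoordinates`): for `g ∈ 𝔪_O^q ∖ 𝔪_O^{q+1}` there is a
unit `v ∈ O` such that for every `N` some `K`-linear differential operator `D` of `O` of order `≤ p^N q` satisfies
`D(g^{p^N} F) − v^{p^N} F ∈ 𝔪_O^{p^N}` for all `F`. [cite: EGAIV4, §16.8 and Thm. 16.11.2]
[cite: Matsumura1987, §27 (higher derivations)] -/
theorem exists_isDiffOpLE_pow_mul_sub_mem_pow_of_etaleCoordinates [PerfectField K]
    [Algebra.FormallySmooth (MvPolynomial σ K) A] [Algebra.FormallyUnramified (MvPolynomial σ K) A]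
    [Algebra.FiniteType K A] (𝔭 : Ideal A) [𝔭.IsMaximal] (O : Type*) [CommRing O] [IsLocalRing O] [Algebra A O]
    [IsLocalization.AtPrime O 𝔭] [Algebra K O] [IsScalarTower K A O] (p : ℕ) [ExpChar O p]
    {q : ℕ} {g : O} (h1 : g ∈ maximalIdeal O ^ q) (h2 : g ∉ maximalIdeal O ^ (q + 1)) :
    ∃ v : O, IsUnit v ∧ ∀ N : ℕ, ∃ D : O →ₗ[K] O, IsDiffOpLE K (p ^ N * q) D ∧
      ∀ F : O, D (g ^ p ^ N * F) - v ^ p ^ N * F ∈ maximalIdeal O ^ p ^ N := by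
  obtain ⟨T, u, hT0, hTK, hspan, hlin⟩ := exists_hasseSchmidt_adapted_of_etaleCoordinates K (σ := σ) 𝔭 O
  exact exists_isDiffOpLE_pow_mul_sub_mem_pow T p hT0 hTK hspan hlin h1 h2

end EtaleCoordinates

/-! ## Stalks of schemes smooth over a perfect field -/

section Stalk

variable {K : Type u} [Field K] {Z : Scheme.{u}} (f : Z ⟶ Spec (.of K))

/-- **Adapted Hasse–Schmidt homomorphism at a closed point of a smooth scheme over a perfect field.** For
`f : Z → Spec K` smooth, `K` perfect, and `ξ ∈ Z` closed, the local ring `𝒪_{Z,ξ}` (with its `K`-structure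
`K → Γ(Z,𝒪_Z) → 𝒪_{Z,ξ}`) carries, for some `d`, a ring homomorphism `T : 𝒪_{Z,ξ} → 𝒪_{Z,ξ}⟦t_1,…,t_d⟧` with
`constantCoeff ∘ T = id` sending `K` to constants, and generators `u_1,…,u_d` of `𝔪_ξ` adapted to `T` to first order
(a standard-smooth affine chart at `ξ` is étale over `K[X_1,…,X_d]`; then `exists_hasseSchmidt_adapted_of_etaleCoordinates`).
[cite: EGAIV4, Thm. 16.11.2 and §17.6] [cite: VillamayorU2008ReesDiff, §4.1 and Remark 4.3] -/
theorem exists_hasseSchmidt_adapted_stalk_of_smooth [PerfectField K] [Smooth f] (ξ : Z)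
    (hξ : IsClosed ({ξ} : Set Z)) :
    letI := stalkAlgebra (f.appTop.hom.comp (Scheme.ΓSpecIso (.of K)).inv.hom) ξ
    ∃ (d : ℕ) (T : Z.presheaf.stalk ξ →+* MvPowerSeries (Fin d) (Z.presheaf.stalk ξ))
      (u : Fin d → Z.presheaf.stalk ξ),
      (∀ b, constantCoeff (T b) = b) ∧
      (∀ c : K, T (algebraMap K (Z.presheaf.stalk ξ) c) = MvPowerSeries.C (algebraMap K (Z.presheaf.stalk ξ) c)) ∧
      Ideal.span (Set.range u) = maximalIdeal (Z.presheaf.stalk ξ) ∧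
      ∀ i j, hsComponent T (Finsupp.single j 1) (u i) - (if i = j then 1 else 0) ∈
        maximalIdeal (Z.presheaf.stalk ξ) := by
  set φ₀ : K →+* Γ(Z, ⊤) := f.appTop.hom.comp (Scheme.ΓSpecIso (.of K)).inv.hom with hφ₀
  letI := stalkAlgebra φ₀ ξ
  -- a standard smooth affine chart at `ξ`
  have hx : ξ ∈ f.smoothLocus := by
    rw [Scheme.Hom.smoothLocus_eq_top]
    trivial
  obtain ⟨d, ⟨U, hU⟩, ⟨V, hV⟩, hξV, e', hstd⟩ :=
    Literature.AlgebraicGeometry.Motives.exists_appLE_isStandardSmoothOfRelativeDimension_of_mem_smoothLocus f hx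
  have hUtop : U = ⊤ := by
    ext y
    simp only [Opens.coe_top, Set.mem_univ, iff_true]
    have : f ξ ∈ U := e' hξV
    rwa [Subsingleton.elim y (f ξ)]
  subst hUtop
  -- its `K`-structure is the sections `K`-structure `K → Γ(Z, 𝒪_Z) → Γ(Z, V)`
  have hφ : sectionsHom φ₀ V =
      (f.appLE ⊤ V e').hom.comp (Scheme.ΓSpecIso (.of K)).commRingCatIsoToRingEquiv.symm.toRingHom := rfl
  have hφstd : (sectionsHom φ₀ V).IsStandardSmoothOfRelativeDimension d := by
    rw [hφ]
    exact RingHom.isStandardSmoothOfRelativeDimension_respectsIso.2 _ _ hstd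
  obtain ⟨g, hgC, hgEt⟩ := RingHom.IsStandardSmoothOfRelativeDimension.exists_etale_mvPolynomial hφstd
  -- algebra structures `K → K[X] → Γ(Z, V) → 𝒪_{Z,ξ}`
  letI : Algebra K Γ(Z, V) := sectionsAlgebra φ₀ V
  letI : Algebra (MvPolynomial (Fin d) K) Γ(Z, V) := g.toAlgebra
  haveI : IsScalarTower K (MvPolynomial (Fin d) K) Γ(Z, V) :=
    IsScalarTower.of_algebraMap_eq (R := K) (S := MvPolynomial (Fin d) K) (A := Γ(Z, V)) fun c => by
      show sectionsHom φ₀ V c = g (algebraMap K (MvPolynomial (Fin d) K) c)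
      rw [MvPolynomial.algebraMap_eq, ← hgC]
      rfl
  haveI : Algebra.Etale (MvPolynomial (Fin d) K) Γ(Z, V) := hgEt
  haveI : Algebra.FormallyEtale (MvPolynomial (Fin d) K) Γ(Z, V) := Algebra.Etale.formallyEtale
  haveI : Algebra.FinitePresentation (MvPolynomial (Fin d) K) Γ(Z, V) := Algebra.Etale.finitePresentation
  haveI : Algebra.FiniteType K Γ(Z, V) :=
    Algebra.FiniteType.trans (S := MvPolynomial (Fin d) K) inferInstance inferInstance
  letI : Algebra Γ(Z, V) (Z.presheaf.stalk ξ) := TopCat.Presheaf.algebra_section_stalk Z.presheaf ⟨ξ, hξV⟩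
  haveI : IsLocalization.AtPrime (Z.presheaf.stalk ξ) (hV.primeIdealOf ⟨ξ, hξV⟩).asIdeal :=
    hV.isLocalization_stalk ⟨ξ, hξV⟩
  haveI : (hV.primeIdealOf ⟨ξ, hξV⟩).asIdeal.IsMaximal := hV.primeIdealOf_isMaximal_of_isClosed ⟨ξ, hξV⟩ hξ
  haveI : IsScalarTower K Γ(Z, V) (Z.presheaf.stalk ξ) :=
    IsScalarTower.of_algebraMap_eq (R := K) (S := Γ(Z, V)) (A := Z.presheaf.stalk ξ) fun c => by
      show stalkHom φ₀ ξ c = (Z.presheaf.germ V ξ hξV).hom (sectionsHom φ₀ V c)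
      rw [← germ_comp_sectionsHom φ₀ V ξ hξV]
      rfl
  obtain ⟨T, u, hT0, hTK, hspan, hlin⟩ := exists_hasseSchmidt_adapted_of_etaleCoordinates K (σ := Fin d)
    (hV.primeIdealOf ⟨ξ, hξV⟩).asIdeal (Z.presheaf.stalk ξ)
  exact ⟨d, T, u, hT0, hTK, hspan, hlin⟩

/-- **Frobenius congruence at a closed point of a smooth scheme over a perfect field** (characteristic exponent `p`):
for `ξ ∈ Z` closed and `g ∈ 𝔪_ξ^q ∖ 𝔪_ξ^{q+1}` there is a unit `v ∈ 𝒪_{Z,ξ}` such that for every `N` some `K`-linear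
differential operator `D` of `𝒪_{Z,ξ}` of order `≤ p^N q` satisfies `D(g^{p^N} F) − v^{p^N} F ∈ 𝔪_ξ^{p^N}` for all `F`
(the `K`-structure being `K → Γ(Z,𝒪_Z) → 𝒪_{Z,ξ}`). [cite: EGAIV4, §16.8 and Thm. 16.11.2]
[cite: Matsumura1987, §27 (higher derivations)] -/
theorem exists_isDiffOpLE_pow_mul_sub_mem_pow_stalk_of_smooth [PerfectField K] [Smooth f] (ξ : Z)
    (hξ : IsClosed ({ξ} : Set Z)) (p : ℕ) [ExpChar (Z.presheaf.stalk ξ) p] {q : ℕ} {g : Z.presheaf.stalk ξ}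
    (h1 : g ∈ maximalIdeal (Z.presheaf.stalk ξ) ^ q) (h2 : g ∉ maximalIdeal (Z.presheaf.stalk ξ) ^ (q + 1)) :
    letI := stalkAlgebra (f.appTop.hom.comp (Scheme.ΓSpecIso (.of K)).inv.hom) ξ
    ∃ v : Z.presheaf.stalk ξ, IsUnit v ∧ ∀ N : ℕ,
      ∃ D : Z.presheaf.stalk ξ →ₗ[K] Z.presheaf.stalk ξ, IsDiffOpLE K (p ^ N * q) D ∧
        ∀ F, D (g ^ p ^ N * F) - v ^ p ^ N * F ∈ maximalIdeal (Z.presheaf.stalk ξ) ^ p ^ N := by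
  letI := stalkAlgebra (f.appTop.hom.comp (Scheme.ΓSpecIso (.of K)).inv.hom) ξ
  obtain ⟨d, T, u, hT0, hTK, hspan, hlin⟩ := exists_hasseSchmidt_adapted_stalk_of_smooth f ξ hξ
  exact exists_isDiffOpLE_pow_mul_sub_mem_pow T p hT0 hTK hspan hlin h1 h2

end Stalk

end Literature.AlgebraicGeometry.Resolution
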